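import Summits.SmoothPoincare4.SmoothPoincare4.Theses.CongruenceShadows
import Summits.SmoothPoincare4.SmoothPoincare4.Theses.GroupTrisection
import Summits.SmoothPoincare4.SmoothPoincare4.Theorems.CongruenceShadowsAgkCor6SufficiencyStubFillingUniqueness
import Summits.SmoothPoincare4.SmoothPoincare4.Theorems.CongruenceShadowsAgkCor6SufficiencyStubHandlebodyExtension
import Summits.SmoothPoincare4.SmoothPoincare4.Theorems.CongruenceShadowsAgkCor6SufficiencyStubDehnNielsenBaer
import Summits.SmoothPoincare4.SmoothPoincare4.Theorems.CongruenceShadowsAgkCor6SufficiencyStubCoredReassembly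
import Summits.SmoothPoincare4.SmoothPoincare4.Theorems.CongruenceShadowsAgkCor6SufficiencyStubUnitSector
import Summits.SmoothPoincare4.SmoothPoincare4.Theorems.CongruenceShadowsAgkCor6SufficiencyStubTubeStructure
import Summits.SmoothPoincare4.SmoothPoincare4.Theorems.CongruenceShadowsAgkCor6SufficiencyStubProductLike
import Summits.SmoothPoincare4.SmoothPoincare4.Theorems.CongruenceShadowsAgkCor6SufficiencyStubSeamDiffeos
import Summits.SmoothPoincare4.SmoothPoincare4.Theorems.CongruenceShadowsAgkCor6SufficiencyStubSeamForm
import Summits.SmoothPoincare4.SmoothPoincare4.Theorems.CongruenceShadowsAgkCor6SufficiencyStubSeamFlow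
import Summits.SmoothPoincare4.SmoothPoincare4.Theorems.CongruenceShadowsAgkCor6SufficiencyStubTransport
import Summits.SmoothPoincare4.SmoothPoincare4.Theorems.CongruenceShadowsAgkCor6SufficiencyStubCores
import Literature.Topology.FourManifolds.TrisectionFunctorSPC4Proofs
import Literature.Topology.FourManifolds.TrisectionsProofs
import Literature.Topology.FourManifolds.SPC4Handles
import Literature.Topology.FourManifolds.HandlebodyKernelExtension
import Literature.Topology.FourManifolds.DehnNielsenBaerSurface
import Literature.Topology.FourManifolds.TrisectionsTriNormalForm

/-!
# Crux `AgkCor6Sufficiency` (item stmt-SmoothPoincare4-10894, routes CongruenceShadows / GroupTrisection):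
# Abrams–Gay–Kirby Cor. 6 ⇐ from the line `lp-by-sphere-system-surgery`, CONDITIONAL on four named facts

`AgkCor6Sufficiency := X → SmoothPoincare4` with `X` = AGK's Cor. 6 condition ("every `(3k, k)` group
trisection of the trivial group is stably trivial").  In the tree the crux is the two AGK leaves
(b′) `diffeomorph_of_iso_groupGKTrisectionOf` (rigidity) and (c′) `exists_stabilized_gkTrisection`
(stabilisation), GK Thm 4 being discharged (`spc4_of_forall_isStablyTrivial_of_three_leaves`,
`exists_isBalancedGKTrisection_holds`; `cruxBody_of_two_leaves`).  The line proves (b′) from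
Dehn–Nielsen–Baer on the central surfaces, handlebody extension, spine rigidity with cores and
cored reassembly:

* **PROVED unconditionally here** (the geometric heart of AGK Thm 5, "the spine determines a
  neighbourhood"): `spineRigidityWithCores_of_handlebodyExtension : HandlebodyExtension →
  SpineRigidityWithCores`, from the eight landed stubs of the spine-transport chain
  (`stub_unitSector`, `stub_tubeStructure`, `stub_productLike`, `stub_seamDiffeos`, `stub_seamForm`,
  `stub_seamFlow`, `stub_transport`, `stub_cores`) by the glue `spineRigidityWithCores_of_chain`
  (tri-normal forms of both trisections, unit normalisation of the six sectors, product structures of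
  the normal frames, ambient extensions of `ψ^{±1}`, seam diffeomorphisms, the common scale
  `r₀ = min(rb, rb′, rP)/20`, seam normalisation, seam flows, transport, cores);
* the landed glue `stub_fillingUniqueness` (LP ⇒ filling uniqueness), `stub_handlebodyExtension`
  (Griffiths ⇒ handlebody extension), `stub_dehnNielsenBaer` (DNB on `∂H_g` ⇒ DNB on central
  surfaces), `stub_coredReassembly` (filling uniqueness ⇒ cored reassembly);
* whence `agkCor6Sufficiency_of_facts` / `agkCor6Sufficiency'_of_facts`: BOTH route decls from the
  four NAMED FACTS of the literature that remain open in the tree — Laudenbach–Poénaru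
  `exists_diffeomorph_comp_incl_eq` (contains Cerf's `Γ₄ = 0`), Griffiths' theorem
  `GriffithsExtension`, Dehn–Nielsen–Baer surjectivity `DehnNielsenBaerSurfaceSmooth`, and (c′)
  `exists_stabilized_gkTrisection` — a CONDITIONAL result; the item closes when these facts land.

References: Abrams–Gay–Kirby, Geom. Topol. 22 (2018), Thm. 5 and Cor. 6 [AbramsGayKirby2018];
Gay–Kirby, Geom. Topol. 20 (2016), Thm. 4 [GayKirby2016]; Laudenbach–Poénaru, Bull. SMF 100 (1972)
[LaudenbachPoenaru1972]; Griffiths, Abh. Math. Sem. Hamburg 26 (1964) [Griffiths1964].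
-/

set_option linter.dupNamespace false

noncomputable section

open Set Function ContinuousMap
open scoped Manifold ContDiff Topology

namespace Summit.SmoothPoincare4.SmoothPoincare4.Cruxes.AgkCor6Sufficiency.LpBySphereSystemSurgery

open Literature.Topology.FourManifolds
open Summit.SmoothPoincare4.SmoothPoincare4.Theses.CongruenceShadows (AgkCor6Sufficiency)

/-! ## 0. The crux is (b′) + (c′) (tree assembly, GK Thm 4 discharged) -/

/-- The BODY of the crux (both route decls `CongruenceShadows.AgkCor6Sufficiency` and
`GroupTrisection.AgkCor6Sufficiency` unfold to it verbatim) from the two AGK leaves (b′), (c′) alone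
(W.lean / AxCheck `twoLeaves`).  Stated on the body so that exactly one theorem below concludes each
route decl by name. -/
theorem cruxBody_of_two_leaves (hb : diffeomorph_of_iso_groupGKTrisectionOf.{0})
    (hc : exists_stabilized_gkTrisection.{0}) :
    (∀ (k : ℕ) (K : TrisectionKernels (3 * k)),
        IsGroupTrisection (3 * k) k (PUnit : Type) K → K.IsStablyTrivial) →
      ∀ (M : Type) [TopologicalSpace M] [T2Space M] [SecondCountableTopology M],
        ContinuousMap.HomotopyEquiv.NonemptyDiffeomorphSphere M 4 :=
  fun hst M _ _ _ =>
    spc4_of_forall_isStablyTrivial_of_three_leaves exists_isBalancedGKTrisection_holds hb hc hst M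

/-! ## 1. The two statements of the line not declared by a stub module -/

/-- **Geometric rigidity** (the group-theory-free half of (b′); Abrams–Gay–Kirby Thm 5 proof,
pp. 1541–1542, with Laudenbach–Poénaru replaced by `FillingUniqueness`): two closed connected
oriented smooth `4`-manifolds with balanced `(g, k)` Gay–Kirby trisections whose central surfaces
are related by a based, ambiently smooth homeomorphism `ψ` carrying each handlebody kernel
`ker (π₁ F → π₁ Hᵢ)` onto the corresponding one are diffeomorphic.  (Extend `ψ` over the three
handlebodies — `HandlebodyExtension` —, then over a regular neighbourhood of the spine
`H₀ ∪ H₁ ∪ H₂` using the corner charts / bicollars of `IsGKTrisection`; the three complements are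
`1`-handlebody fillings of identified boundaries, matched by `FillingUniqueness`; glue.) -/
def GeometricRigidity : Prop :=
  ∀ (X : Type) [TopologicalSpace X] [T2Space X] [SecondCountableTopology X]
    [ChartedSpace (EuclideanSpace ℝ (Fin 4)) X] [IsManifold (𝓡 4) ∞ X] [CompactSpace X]
    [ConnectedSpace X] (_ : SmoothOrientation (𝓡 4) X)
    (X' : Type) [TopologicalSpace X'] [T2Space X'] [SecondCountableTopology X']
    [ChartedSpace (EuclideanSpace ℝ (Fin 4)) X'] [IsManifold (𝓡 4) ∞ X'] [CompactSpace X']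
    [ConnectedSpace X'] (_ : SmoothOrientation (𝓡 4) X')
    (g k : ℕ) (S : Fin 3 → Set X) (S' : Fin 3 → Set X')
    (_ : IsBalancedGKTrisection X g k S) (_ : IsBalancedGKTrisection X' g k S')
    (x₀ : centralSurface S) (x₀' : centralSurface S')
    (ψ : centralSurface S ≃ₜ centralSurface S') (hψ : ψ x₀ = x₀'),
    AmbientSmooth S S' ψ → AmbientSmooth S' S ψ.symm →
    (∀ i : Fin 3, ((FundamentalGroup.map (centralInclusion S i) x₀).ker).map
        (FundamentalGroup.mapOfEq (⟨ψ, ψ.continuous⟩ : C(centralSurface S, centralSurface S')) hψ)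
        = (FundamentalGroup.map (centralInclusion S' i) x₀').ker) →
      Nonempty (X ≃ₘ⟮𝓡 4, 𝓡 4⟯ X')

/-- **Spine rigidity with cores** (lead reshape r3; the genuine geometric content of the AGK
Thm 5 assembly = `GeometricRigidity` minus its LP/gluing half): under the hypotheses of
`GeometricRigidity` (two closed connected oriented balanced-`(g,k)`-GK-trisected `X`, `X'`, a
based ambiently smooth homeomorphism `ψ` of the central surfaces carrying each handlebody kernel
onto its counterpart), there are smooth functions `f`, `f'` on `X`, `X'` with regular level `1/2`
whose superlevel sets are disjoint unions of three compact connected orientable `1`-handlebodies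
(cores of the sectors, shrunk along collars of the abstract sectors `W` of clause (ii)) and whose
sublevel sets — closed regular neighbourhoods of the spines `H₀ ∪ H₁ ∪ H₂`, `H'₀ ∪ H'₁ ∪ H'₂` —
are DIFFEOMORPHIC (extend `ψ` over the handlebodies by `HandlebodyExtension`, a hypothesis of the
registered stub, then over the three one-sided collars using compatible collars at the corner
stratum `F`; Abrams–Gay–Kirby, proof of Thm. 5, pp. 1541–1542). -/
def SpineRigidityWithCores : Prop :=
  ∀ (X : Type) [TopologicalSpace X] [T2Space X] [SecondCountableTopology X]
    [ChartedSpace (EuclideanSpace ℝ (Fin 4)) X] [IsManifold (𝓡 4) ∞ X] [CompactSpace X]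
    [ConnectedSpace X] (_ : SmoothOrientation (𝓡 4) X)
    (X' : Type) [TopologicalSpace X'] [T2Space X'] [SecondCountableTopology X']
    [ChartedSpace (EuclideanSpace ℝ (Fin 4)) X'] [IsManifold (𝓡 4) ∞ X'] [CompactSpace X']
    [ConnectedSpace X'] (_ : SmoothOrientation (𝓡 4) X')
    (g k : ℕ) (S : Fin 3 → Set X) (S' : Fin 3 → Set X')
    (_ : IsBalancedGKTrisection X g k S) (_ : IsBalancedGKTrisection X' g k S')
    (x₀ : centralSurface S) (x₀' : centralSurface S')
    (ψ : centralSurface S ≃ₜ centralSurface S') (hψ : ψ x₀ = x₀'),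
    AmbientSmooth S S' ψ → AmbientSmooth S' S ψ.symm →
    (∀ i : Fin 3, ((FundamentalGroup.map (centralInclusion S i) x₀).ker).map
        (FundamentalGroup.mapOfEq (⟨ψ, ψ.continuous⟩ : C(centralSurface S, centralSurface S')) hψ)
        = (FundamentalGroup.map (centralInclusion S' i) x₀').ker) →
    ∃ (f : X → ℝ) (f' : X' → ℝ) (hf : IsRegularLevel (𝓡 4) f (1 / 2))
      (hf' : IsRegularLevel (𝓡 4) f' (1 / 2))
      (V : Fin 3 → Type) (_ : ∀ i, TopologicalSpace (V i)) (_ : ∀ i, T2Space (V i))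
      (_ : ∀ i, SecondCountableTopology (V i)) (_ : ∀ i, CompactSpace (V i))
      (_ : ∀ i, ConnectedSpace (V i)) (_ : ∀ i, ChartedSpace (EuclideanHalfSpace 4) (V i))
      (_ : ∀ i, IsManifold (𝓡∂ 4) ∞ (V i))
      (_ : ∀ i, IsHandlebodyOfIndexLE 3 1 (V i)) (_ : ∀ i, IsOrientable (𝓡∂ 4) (V i))
      (V' : Fin 3 → Type) (_ : ∀ i, TopologicalSpace (V' i)) (_ : ∀ i, T2Space (V' i))
      (_ : ∀ i, SecondCountableTopology (V' i)) (_ : ∀ i, CompactSpace (V' i))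
      (_ : ∀ i, ConnectedSpace (V' i)) (_ : ∀ i, ChartedSpace (EuclideanHalfSpace 4) (V' i))
      (_ : ∀ i, IsManifold (𝓡∂ 4) ∞ (V' i))
      (_ : ∀ i, IsHandlebodyOfIndexLE 3 1 (V' i)) (_ : ∀ i, IsOrientable (𝓡∂ 4) (V' i))
      (_ : RegularSuperlevel hf ≃ₘ⟮𝓡∂ 4, 𝓡∂ 4⟯ (V 0 ⊕ (V 1 ⊕ V 2)))
      (_ : RegularSuperlevel hf' ≃ₘ⟮𝓡∂ 4, 𝓡∂ 4⟯ (V' 0 ⊕ (V' 1 ⊕ V' 2))),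
      Nonempty (RegularSublevel hf ≃ₘ⟮𝓡∂ 4, 𝓡∂ 4⟯ RegularSublevel hf')


/-! ## 2. Glue (all proved) -/

/-- **Spine rigidity with cores from the r5 chain** (lead reshape r5, proved glue): tri-normal
forms of both trisections (tree), unit normalisation of the six sectors, the two product
structures, the ambient extensions of `ψ^{±1}`, the seam diffeomorphisms at some radius `rP`,
the common scale `r₀ ≤ min (rt, rt', rP, unit radii) / 20`, seam normalisation and seam flows on
both sides, transport, cores. -/
theorem spineRigidityWithCores_of_chain (hA1 : UnitSectorStmt) (hTS : TubeStructureStmt)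
    (hPL : ProductLikeNormalisation)
    (hB2 : ProductLikeNormalisation → HandlebodyExtension → SeamDiffeosStmt)
    (hA3 : SeamFormStmt) (hSF : SeamFlowStmt) (hC : TransportStmt) (hD : CoresStmt) :
    HandlebodyExtension → SpineRigidityWithCores := by
  intro hHE X _ _ _ _ _ _ _ o X' _ _ _ _ _ _ _ o' g k S S' h h' x₀ x₀' ψ hψ hs hs' hker
  -- tri-normal forms (tree)
  obtain ⟨u, v, U, O, ρ, hT⟩ := IsGKTrisection.exists_triNormalForm (i := 0) (j := 1) (l := 2) h
    (by decide) (by decide) (by decide)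
  obtain ⟨u', v', U', O', ρ', hT'⟩ := IsGKTrisection.exists_triNormalForm (i := 0) (j := 1) (l := 2)
    h' (by decide) (by decide) (by decide)
  -- unit normalisation of the six sectors
  obtain ⟨T0, G0, hU0⟩ := hA1 X (S 0) _ u v ρ U O _ hT.frame hT.sector_i
  obtain ⟨T1, G1, hU1⟩ := hA1 X (S 1) _ _ _ ρ U O _ hT.frame.relabelTriRot hT.sector_j
  obtain ⟨T2, G2, hU2⟩ := hA1 X (S 2) _ _ _ ρ U O _ hT.frame.relabelTriRot₂ hT.sector_l
  obtain ⟨T0', G0', hU0'⟩ := hA1 X' (S' 0) _ u' v' ρ' U' O' _ hT'.frame hT'.sector_i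
  obtain ⟨T1', G1', hU1'⟩ := hA1 X' (S' 1) _ _ _ ρ' U' O' _ hT'.frame.relabelTriRot hT'.sector_j
  obtain ⟨T2', G2', hU2'⟩ := hA1 X' (S' 2) _ _ _ ρ' U' O' _ hT'.frame.relabelTriRot₂ hT'.sector_l
  -- product structures
  obtain ⟨Ot, rt, tp, hTS₀⟩ := hTS X (S 0) _ u v ρ U O hT.frame hT.sector_i.corner
  obtain ⟨Ot', rt', tp', hTS₀'⟩ := hTS X' (S' 0) _ u' v' ρ' U' O' hT'.frame hT'.sector_i.corner
  -- ambient extensions of `ψ`, `ψ⁻¹`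
  obtain ⟨Uψ, Ψa, hUψo, hFUψ, hΨas, hΨaψ⟩ := hs
  obtain ⟨Uψ', Ψa', hUψo', hFUψ', hΨas', hΨaψ'⟩ := hs'
  -- seam diffeomorphisms
  obtain ⟨rP, hSD⟩ := hB2 hPL hHE X o X' o' g k S S' h h' x₀ x₀' ψ hψ hker u v ρ U O Ot rt tp
    u' v' ρ' U' O' Ot' rt' tp' hT hT' hTS₀ hTS₀' Uψ Ψa Uψ' Ψa' hUψo hFUψ hΨas hΨaψ hUψo' hFUψ'
    hΨas' hΨaψ'
  -- the common scale `r₀`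
  set Tun : Set X := T0 ∩ T1 ∩ T2 with hTun
  set Tun' : Set X' := T0' ∩ T1' ∩ T2' with hTun'
  obtain ⟨rb, hrb, hrbt, hrbT⟩ := hTS₀.basis Tun ((hU0.isOpen_T.inter hU1.isOpen_T).inter hU2.isOpen_T)
    (subset_inter (subset_inter hU0.F_subset_T hU1.F_subset_T) hU2.F_subset_T)
  obtain ⟨rb', hrb', hrbt', hrbT'⟩ := hTS₀'.basis Tun'
    ((hU0'.isOpen_T.inter hU1'.isOpen_T).inter hU2'.isOpen_T)
    (subset_inter (subset_inter hU0'.F_subset_T hU1'.F_subset_T) hU2'.F_subset_T)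
  set r₀ : ℝ := min (min rb rb') rP / 20 with hr₀
  have hrP : 0 < rP := hSD.1
  have hr₀pos : 0 < r₀ := by positivity
  have h20 : 20 * r₀ = min (min rb rb') rP := by rw [hr₀]; ring
  have h20rb : 20 * r₀ ≤ rb := by rw [h20]; exact (min_le_left _ _).trans (min_le_left _ _)
  have h20rb' : 20 * r₀ ≤ rb' := by rw [h20]; exact (min_le_left _ _).trans (min_le_right _ _)
  have h20rP : 20 * r₀ ≤ rP := by rw [h20]; exact min_le_right _ _
  have h20rt : 20 * r₀ ≤ rt := h20rb.trans hrbt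
  have h20rt' : 20 * r₀ ≤ rt' := h20rb'.trans hrbt'
  have htube : tubeSet Ot u v (20 * r₀) ⊆ T0 ∩ T1 ∩ T2 := by
    refine Subset.trans (fun x hx => ?_) hrbT
    exact ⟨hx.1, lt_of_lt_of_le hx.2 (by nlinarith [h20rb, hr₀pos])⟩
  have htube' : tubeSet Ot' u' v' (20 * r₀) ⊆ T0' ∩ T1' ∩ T2' := by
    refine Subset.trans (fun x hx => ?_) hrbT'
    exact ⟨hx.1, lt_of_lt_of_le hx.2 (by nlinarith [h20rb', hr₀pos])⟩
  -- seam normalisation at scale `r₀`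
  obtain ⟨G, ε₁, N, T₀, -, hP, hT₀, hSFm⟩ := hA3 X S u v ρ U O k ![T0, T1, T2] ![G0, G1, G2] Ot rt tp
    hT hU0 hU1 hU2 hTS₀ r₀ hr₀pos h20rt htube
  obtain ⟨G', ε₁', N', T₀', -, hP', hT₀', hSFm'⟩ := hA3 X' S' u' v' ρ' U' O' k ![T0', T1', T2']
    ![G0', G1', G2'] Ot' rt' tp' hT' hU0' hU1' hU2' hTS₀' r₀ hr₀pos h20rt' htube'
  -- seam flows
  have hfl := hSF X S u v ρ U O T₀ k Ot rt tp G r₀ ε₁ N hP hTS₀ h20rt hSFm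
  have hfl' := hSF X' S' u' v' ρ' U' O' T₀' k Ot' rt' tp' G' r₀ ε₁' N' hP' hTS₀' h20rt' hSFm'
  choose Nf δ φ hφ using hfl
  choose Nf' δ' φ' hφ' using hfl'
  -- transport
  have hΓ : SpineTransport S S' G G' :=
    hC X X' k S S' ψ u v ρ U O T₀ Ot rt tp G ε₁ N Nf δ φ u' v' ρ' U' O' T₀' Ot' rt' tp' G' ε₁' N'
      Nf' δ' φ' Uψ Ψa Uψ' Ψa' r₀ rP hP hTS₀ hSFm hφ hP' hTS₀' hSFm' hφ' hSD h20rP h20rt h20rt'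
      hT₀ hT₀' hUψo hFUψ hΨas hΨaψ hUψo' hFUψ' hΨas' hΨaψ'
  -- cores
  exact hD X o X' o' k S S' u v ρ U O T₀ G u' v' ρ' U' O' T₀' G' hP hP' hΓ

/-- **Geometric rigidity from spine rigidity and cored reassembly** (lead reshape r3, proved
glue): the spine half supplies the two cored presentations and the diffeomorphism of spine
neighbourhoods, the reassembly half glues the `1`-handlebody cores back by filling uniqueness. -/
theorem geometricRigidity_of_spine_of_cored
    (hSR : HandlebodyExtension → SpineRigidityWithCores)
    (hCR : FillingUniqueness → CoredReassembly) :
    FillingUniqueness → HandlebodyExtension → GeometricRigidity := by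
  intro hFU hHE X _ _ _ _ _ _ _ o X' _ _ _ _ _ _ _ o' g k S S' h h' x₀ x₀' ψ hψ hs hs' hker
  obtain ⟨f, f', hf, hf', V, i₁, i₂, i₃, i₄, i₅, i₆, i₇, hV, hVo, V', j₁, j₂, j₃, j₄, j₅, j₆, j₇,
    hV', hVo', eV, eV', ⟨Θ⟩⟩ := hSR hHE X o X' o' g k S S' h h' x₀ x₀' ψ hψ hs hs' hker
  exact hCR hFU X o X' o' f f' hf hf' V i₁ i₂ i₃ i₄ i₅ i₆ i₇ hV hVo V' j₁ j₂ j₃ j₄ j₅ j₆ j₇ hV'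
    hVo' eV eV' Θ

section Bookkeeping

variable {A B : Type*} [Group A] [Group B]

/-- `comap` along a group isomorphism is `map` along its inverse. -/
theorem comap_mulEquiv_eq_map_symm (e : A ≃* B) (K : Subgroup B) :
    K.comap e.toMonoidHom = K.map e.symm.toMonoidHom := by
  ext x
  simp only [Subgroup.mem_comap, MulEquiv.coe_toMonoidHom, Subgroup.mem_map]
  constructor
  · intro hx
    exact ⟨e x, hx, by simp⟩
  · rintro ⟨y, hy, rfl⟩
    simpa using hy

/-- `map` along a group isomorphism followed by `map` along its inverse is the identity. -/
theorem map_map_symm (e : A ≃* B) (K : Subgroup B) :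
    (K.map e.symm.toMonoidHom).map e.toMonoidHom = K := by
  rw [Subgroup.map_map]
  have : e.toMonoidHom.comp e.symm.toMonoidHom = MonoidHom.id B := MonoidHom.ext fun x => by simp
  rw [this, Subgroup.map_id]

end Bookkeeping

/-- **(b′) from geometric rigidity and Dehn–Nielsen–Baer** — the marking bookkeeping, proved:
an `Iso` of kernel triples through markings `μ, μ'` is an isomorphism
`θ = μ' ∘ α ∘ μ⁻¹ : π₁(F, x₀) ≅ π₁(F', x₀')` carrying each handlebody kernel onto the corresponding
one; DNB realises `θ` by a based ambiently-smooth homeomorphism, and geometric rigidity concludes. -/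
theorem rigidity_of_geometricRigidity_of_dnb (hgeo : GeometricRigidity)
    (hdnb : DehnNielsenBaerCentral) : diffeomorph_of_iso_groupGKTrisectionOf.{0} := by
  intro X _ _ _ _ _ _ _ o X' _ _ _ _ _ _ _ o' g k S S' h h' x₀ x₀' μ μ' hiso
  obtain ⟨α, hα⟩ := hiso
  -- the induced isomorphism of surface fundamental groups
  let θ : FundamentalGroup (centralSurface S) x₀ ≃* FundamentalGroup (centralSurface S') x₀' :=
    μ.symm.trans (α.trans μ')
  obtain ⟨ψ, hψ, hs, hs', hind⟩ := hdnb X o X' o' g k S S' h h' x₀ x₀' μ θ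
  refine hgeo X o X' o' g k S S' h h' x₀ x₀' ψ hψ hs hs' fun i => ?_
  -- `ψ_* = θ` as homomorphisms
  have hψθ : (FundamentalGroup.mapOfEq (⟨ψ, ψ.continuous⟩ : C(centralSurface S, centralSurface S')) hψ)
      = θ.toMonoidHom := MonoidHom.ext fun γ => hind γ
  rw [hψθ]
  -- kernel bookkeeping: `K i = (ker ιᵢ).comap μ`, `(K i).map α = K' i = (ker ι'ᵢ).comap μ'`
  have hKi : (FundamentalGroup.map (centralInclusion S i) x₀).ker
      = (groupGKTrisectionOf h x₀ μ i).map μ.toMonoidHom := by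
    show _ = (((FundamentalGroup.map (centralInclusion S i) x₀).ker).comap μ.toMonoidHom).map μ.toMonoidHom
    rw [comap_mulEquiv_eq_map_symm, map_map_symm]
  have hcomp : θ.toMonoidHom.comp μ.toMonoidHom = μ'.toMonoidHom.comp α.toMonoidHom :=
    MonoidHom.ext fun x => by simp [θ]
  calc ((FundamentalGroup.map (centralInclusion S i) x₀).ker).map θ.toMonoidHom
      = ((groupGKTrisectionOf h x₀ μ i).map μ.toMonoidHom).map θ.toMonoidHom := by rw [hKi]
    _ = (groupGKTrisectionOf h x₀ μ i).map (θ.toMonoidHom.comp μ.toMonoidHom) := by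
        rw [Subgroup.map_map]
    _ = (groupGKTrisectionOf h x₀ μ i).map (μ'.toMonoidHom.comp α.toMonoidHom) := by rw [hcomp]
    _ = ((groupGKTrisectionOf h x₀ μ i).map α.toMonoidHom).map μ'.toMonoidHom := by
        rw [Subgroup.map_map]
    _ = (groupGKTrisectionOf h' x₀' μ' i).map μ'.toMonoidHom := by rw [hα i]
    _ = (FundamentalGroup.map (centralInclusion S' i) x₀').ker := by
        show ((((FundamentalGroup.map (centralInclusion S' i) x₀').ker).comap μ'.toMonoidHom).map
          μ'.toMonoidHom) = _
        rw [comap_mulEquiv_eq_map_symm, map_map_symm]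


/-! ## 3. The results -/

/-- **PROVED: spine rigidity with cores from handlebody extension** — the geometric heart of
Abrams–Gay–Kirby's Thm. 5 ("the spine `H₀ ∪ H₁ ∪ H₂` determines a neighbourhood"), by the
spine-transport chain of the line (eight landed stubs). [cite: AbramsGayKirby2018, proof of Thm. 5] -/
theorem spineRigidityWithCores_of_handlebodyExtension : HandlebodyExtension → SpineRigidityWithCores :=
  spineRigidityWithCores_of_chain stub_unitSector stub_tubeStructure stub_productLike stub_seamDiffeos
    stub_seamForm stub_seamFlow stub_transport stub_cores

/-- **PROVED: geometric rigidity from the two classical three- and four-dimensional facts** Laudenbach–Poénaru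
(`exists_diffeomorph_comp_incl_eq`) and Griffiths (`GriffithsExtension`).
[cite: AbramsGayKirby2018, proof of Thm. 5] -/
theorem geometricRigidity_of_facts (hLP : exists_diffeomorph_comp_incl_eq.{0})
    (hGr : GriffithsExtension) : GeometricRigidity :=
  geometricRigidity_of_spine_of_cored spineRigidityWithCores_of_handlebodyExtension stub_coredReassembly
    (stub_fillingUniqueness hLP) (stub_handlebodyExtension hGr)

/-- **PROVED: AGK Thm 5 (b′), rigidity, from three named facts** (LP, Griffiths, Dehn–Nielsen–Baer
on `∂H_g`). [cite: AbramsGayKirby2018, Thm. 5] -/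
theorem rigidity_of_facts (hLP : exists_diffeomorph_comp_incl_eq.{0}) (hGr : GriffithsExtension)
    (hDS : DehnNielsenBaerSurfaceSmooth) : diffeomorph_of_iso_groupGKTrisectionOf.{0} :=
  rigidity_of_geometricRigidity_of_dnb (geometricRigidity_of_facts hLP hGr) (stub_dehnNielsenBaer hDS)

/-- **The crux of route `CongruenceShadows` from the four named facts** (Laudenbach–Poénaru,
Griffiths, Dehn–Nielsen–Baer, (c′) stabilisation) — CONDITIONAL result.
[cite: AbramsGayKirby2018, Cor. 6] -/
theorem agkCor6Sufficiency_of_facts (hLP : exists_diffeomorph_comp_incl_eq.{0})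
    (hGr : GriffithsExtension) (hDS : DehnNielsenBaerSurfaceSmooth)
    (hc : exists_stabilized_gkTrisection.{0}) : AgkCor6Sufficiency :=
  cruxBody_of_two_leaves (rigidity_of_facts hLP hGr hDS) hc

/-- **The crux of route `GroupTrisection` (identical body) from the four named facts** —
CONDITIONAL result. [cite: AbramsGayKirby2018, Cor. 6] -/
theorem agkCor6Sufficiency'_of_facts (hLP : exists_diffeomorph_comp_incl_eq.{0})
    (hGr : GriffithsExtension) (hDS : DehnNielsenBaerSurfaceSmooth)
    (hc : exists_stabilized_gkTrisection.{0}) :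
    Summit.SmoothPoincare4.SmoothPoincare4.Theses.GroupTrisection.AgkCor6Sufficiency :=
  cruxBody_of_two_leaves (rigidity_of_facts hLP hGr hDS) hc

end Summit.SmoothPoincare4.SmoothPoincare4.Cruxes.AgkCor6Sufficiency.LpBySphereSystemSurgery

end
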